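import Summits.Ventures.LatticeQCDFlow.TrivializingMaps.ReweightingStepLawAnyGroup

/-!
HONEST FRAMING: exact (Metropolis-corrected) sampling algorithms for lattice gauge theory; figures
of merit are autocorrelation/cost numbers at stated couplings and volumes; no continuum-physics
claim.

# AnnealingAnyGroup — STRONG-COUPLING REWEIGHTING AND ANNEALING LAWS FOR EVERY COMPACT GAUGE GROUP;
# `U(1)`: `E[w²] ≥ exp(δ²·#plaq/4)` PER STEP, `k ≥ #plaq·(Δβ)²/(4·cost)` STEPS (lean-2 GEN-8, ours)

Venture-side (OURS).  Cell `lqcd-flow` (pub-lqcd), unit `pub-lqcd-lean-2-g8`, 2026-08-22.  Sequel of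
`ReweightingStepLawAnyGroup` (the exact one-step law, every compact `G`) and `SpecificHeatAnyGroup` (the
volume-uniform floor `Var_u(S_W^ρ) ≥ v_ρ·#plaq/2` on the window `|u| ≤ min (r/8) (v_ρ r³/512)`,
`r = 1/(4e·max(1,2N)·(3^d d²+1)²)`, unitary `ρ`, `L ≥ 2`, `v_ρ = Var_Haar(Re tr ρ)`):

* `wilson_variance_ge_half_anyGroup` — the floor as a lemma;
* **`wilson_weight_sq_ge_exp_anyGroup`** — one exact reweighting step `β → β+δ` inside the window has
  weight second moment `≥ exp(δ²·v_ρ·#plaq/2)`;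
* **`wilson_schedule_cost_ge_anyGroup`** — a `k`-step schedule inside the window costs
  `Σ_i Δ²ψ(β_i; δ_i) ≥ v_ρ·#plaq·(β_k − β_0)²/(2k)` (Cauchy–Schwarz): at fixed total weight second moment
  the number of steps is LINEAR IN THE VOLUME, every compact gauge group, closed-form rate;
* **`u1_weight_sq_ge_exp`** — `U(1)` (`v = ½`): `≥ exp(δ²·#plaq/4)`.

NOT CLAIMED: finite-sample ESS; anything outside the window; cost / autocorrelation / continuum
statements.  Literature grade (cell rule): elementary; new typing.
-/

noncomputable section

open MeasureTheory ProbabilityTheory Complex Metric Set Filter Topology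
open Literature.MathematicalPhysics.QuantumFieldTheory
open Literature.MathematicalPhysics.QuantumFieldTheory.Luscher2010
open scoped Matrix Matrix.Norms.Frobenius ContDiff

namespace Summit.Ventures.LatticeQCDFlow.TrivializingMaps

/-! ## §4 Strong coupling, every compact gauge group; `U(1)` -/

section StrongCoupling

variable {d L N : ℕ} [NeZero L] {G : Type*} [Group G] [TopologicalSpace G] [IsTopologicalGroup G]
  [CompactSpace G] [MeasurableSpace G] [BorelSpace G] [SecondCountableTopology G]
  (ρ : G →* Matrix (Fin N) (Fin N) ℂ)


/-- Per-step floors add up (every compact gauge group). [ours] -/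
theorem schedule_sum_ge_of_floors (hρ : Continuous ρ) (k : ℕ) (β δ m : ℕ → ℝ)
    (hδ : ∀ i < k, 0 ≤ δ i)
    (hm : ∀ i < k, ∀ u ∈ Icc (β i) (β i + 2 * δ i),
      m i ≤ variance (wilsonAction (d := d) (L := L) ρ) (wilsonMeasure (d := d) (L := L) ρ u)) :
    ∑ i ∈ Finset.range k, δ i ^ 2 * m i ≤
      ∑ i ∈ Finset.range k,
        (cgf (fun U => -wilsonAction ρ U) (trivialMeasure G d L) (β i + 2 * δ i) -
          2 * cgf (fun U => -wilsonAction ρ U) (trivialMeasure G d L) (β i + δ i) +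
          cgf (fun U => -wilsonAction ρ U) (trivialMeasure G d L) (β i)) :=
  Finset.sum_le_sum fun i hi =>
    cgf_second_difference_ge_anyGroup hρ (hδ i (Finset.mem_range.1 hi)) (hm i (Finset.mem_range.1 hi))

/-- The strong-coupling variance floor `Var_u(S_W^ρ) ≥ v_ρ·#plaq/2` on the window
`|u| ≤ min (r/8) (v_ρ r³/512)` (`SpecificHeatAnyGroup`). [ours] -/
theorem wilson_variance_ge_half_anyGroup (hρ : Continuous ρ)
    (hρu : ∀ g, ρ g ∈ Matrix.unitaryGroup (Fin N) ℂ) (hL : 2 ≤ L) (u : ℝ)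
    (hu : |u| ≤ min (1 / (4 * Real.exp 1 * max 1 (2 * (N : ℝ)) * ((3 : ℝ) ^ d * (d : ℝ) ^ 2 + 1) ^ 2) / 8)
      (variance (fun g => (ρ g).trace.re) (haarProbability G) *
        (1 / (4 * Real.exp 1 * max 1 (2 * (N : ℝ)) * ((3 : ℝ) ^ d * (d : ℝ) ^ 2 + 1) ^ 2)) ^ 3 / 512)) :
    variance (fun g => (ρ g).trace.re) (haarProbability G) * Fintype.card (Plaquette d L) / 2 ≤
      variance (wilsonAction (d := d) (L := L) ρ) (wilsonMeasure (d := d) (L := L) ρ u) := by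
  set r : ℝ := 1 / (4 * Real.exp 1 * max 1 (2 * (N : ℝ)) * ((3 : ℝ) ^ d * (d : ℝ) ^ 2 + 1) ^ 2)
    with hr
  set v := variance (fun g => (ρ g).trace.re) (haarProbability G) with hvdef
  set P : ℝ := (Fintype.card (Plaquette d L) : ℝ) with hP
  have hr0 : 0 < r := kpRadiusGroup_pos d N
  have hP0 : 0 ≤ P := by rw [hP]; positivity
  have hv0 : 0 ≤ v := variance_nonneg _ _
  have hx1 : |u| ≤ r / 8 := hu.trans (min_le_left _ _)
  have hx2 : |u| ≤ v * r ^ 3 / 512 := hu.trans (min_le_right _ _)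
  have hdiff := wilson_variance_sub_le_anyGroup (d := d) (L := L) ρ hρ hρu hL u (by linarith)
  rw [← hr, ← hP, ← hvdef] at hdiff
  have h' := (abs_sub_le_iff.1 hdiff).2
  have hkey : 256 * P * |u| / r ^ 3 ≤ v * P / 2 := by
    rw [div_le_iff₀ (by positivity)]
    have : 256 * |u| ≤ v * r ^ 3 / 2 := by linarith
    nlinarith
  linarith

/-- **EVERY COMPACT GAUGE GROUP, STRONG COUPLING, EVERY `L ≥ 2`**: one exact reweighting step `β → β+δ`
(`δ ≥ 0`, `[β, β+2δ]` in the window) has weight second moment `≥ exp(δ²·v_ρ·#plaq/2)`. [ours] -/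
theorem wilson_weight_sq_ge_exp_anyGroup (hρ : Continuous ρ)
    (hρu : ∀ g, ρ g ∈ Matrix.unitaryGroup (Fin N) ℂ) (hL : 2 ≤ L) {β δ : ℝ} (hδ : 0 ≤ δ)
    (hβ : |β| ≤ min (1 / (4 * Real.exp 1 * max 1 (2 * (N : ℝ)) * ((3 : ℝ) ^ d * (d : ℝ) ^ 2 + 1) ^ 2) / 8)
      (variance (fun g => (ρ g).trace.re) (haarProbability G) *
        (1 / (4 * Real.exp 1 * max 1 (2 * (N : ℝ)) * ((3 : ℝ) ^ d * (d : ℝ) ^ 2 + 1) ^ 2)) ^ 3 / 512))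
    (hβ2 : |β + 2 * δ| ≤
      min (1 / (4 * Real.exp 1 * max 1 (2 * (N : ℝ)) * ((3 : ℝ) ^ d * (d : ℝ) ^ 2 + 1) ^ 2) / 8)
      (variance (fun g => (ρ g).trace.re) (haarProbability G) *
        (1 / (4 * Real.exp 1 * max 1 (2 * (N : ℝ)) * ((3 : ℝ) ^ d * (d : ℝ) ^ 2 + 1) ^ 2)) ^ 3 / 512)) :
    Real.exp (δ ^ 2 * (variance (fun g => (ρ g).trace.re) (haarProbability G) *
        Fintype.card (Plaquette d L) / 2)) ≤
      ∫ U, (Real.exp (-(δ * wilsonAction ρ U)) *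
        (mgf (fun U => -wilsonAction ρ U) (trivialMeasure G d L) β /
          mgf (fun U => -wilsonAction ρ U) (trivialMeasure G d L) (β + δ))) ^ 2
      ∂(wilsonMeasure (d := d) (L := L) ρ β) := by
  refine weight_sq_integral_ge_exp_anyGroup (d := d) (L := L) hρ hδ fun u hu => ?_
  refine wilson_variance_ge_half_anyGroup ρ hρ hρu hL u ?_
  rw [abs_le] at hβ hβ2 ⊢
  exact ⟨by linarith [hβ.1, hu.1], by linarith [hβ2.2, hu.2]⟩

/-- **EVERY COMPACT GAUGE GROUP: a `k`-step schedule inside the window costs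
`≥ v_ρ·#plaq·(β_k − β_0)²/(2k)`** (`β_{i+1} = β_i + δ_i`, `0 ≤ δ_i ≤ D`, `k ≥ 1`). [ours] -/
theorem wilson_schedule_cost_ge_anyGroup (hρ : Continuous ρ)
    (hρu : ∀ g, ρ g ∈ Matrix.unitaryGroup (Fin N) ℂ) (hL : 2 ≤ L) {k : ℕ} (hk : 1 ≤ k)
    (β δ : ℕ → ℝ) (hstep : ∀ i, β (i + 1) = β i + δ i) (hδ : ∀ i < k, 0 ≤ δ i) {D : ℝ}
    (hD : ∀ i < k, δ i ≤ D)
    (hlo : -(min (1 / (4 * Real.exp 1 * max 1 (2 * (N : ℝ)) * ((3 : ℝ) ^ d * (d : ℝ) ^ 2 + 1) ^ 2) / 8)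
      (variance (fun g => (ρ g).trace.re) (haarProbability G) *
        (1 / (4 * Real.exp 1 * max 1 (2 * (N : ℝ)) * ((3 : ℝ) ^ d * (d : ℝ) ^ 2 + 1) ^ 2)) ^ 3 / 512)) ≤ β 0)
    (hhi : β k + D ≤
      min (1 / (4 * Real.exp 1 * max 1 (2 * (N : ℝ)) * ((3 : ℝ) ^ d * (d : ℝ) ^ 2 + 1) ^ 2) / 8)
      (variance (fun g => (ρ g).trace.re) (haarProbability G) *
        (1 / (4 * Real.exp 1 * max 1 (2 * (N : ℝ)) * ((3 : ℝ) ^ d * (d : ℝ) ^ 2 + 1) ^ 2)) ^ 3 / 512)) :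
    variance (fun g => (ρ g).trace.re) (haarProbability G) * Fintype.card (Plaquette d L) *
        (β k - β 0) ^ 2 / (2 * k) ≤
      ∑ i ∈ Finset.range k,
        (cgf (fun U => -wilsonAction ρ U) (trivialMeasure G d L) (β i + 2 * δ i) -
          2 * cgf (fun U => -wilsonAction ρ U) (trivialMeasure G d L) (β i + δ i) +
          cgf (fun U => -wilsonAction ρ U) (trivialMeasure G d L) (β i)) := by
  set v := variance (fun g => (ρ g).trace.re) (haarProbability G) with hvdef
  set P : ℝ := (Fintype.card (Plaquette d L) : ℝ) with hP
  have hm0 : 0 ≤ v * P / 2 := by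
    have : 0 ≤ v := variance_nonneg _ _
    positivity
  -- monotone couplings
  have hsum : ∀ j, β j = β 0 + ∑ i ∈ Finset.range j, δ i := by
    intro j
    induction j with
    | zero => simp
    | succ j ih => rw [hstep, ih, Finset.sum_range_succ]; ring
  have hmono : ∀ j ≤ k, ∀ i ≤ j, β i ≤ β j := by
    intro j hj i hij
    rw [hsum i, hsum j, add_le_add_iff_left]
    exact Finset.sum_le_sum_of_subset_of_nonneg (Finset.range_subset_range.2 hij)
      fun l hl _ => hδ l (lt_of_lt_of_le (Finset.mem_range.1 hl) hj)
  -- per-step floors from the window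
  have hfloor : ∀ i < k, ∀ u ∈ Icc (β i) (β i + 2 * δ i),
      v * P / 2 ≤ variance (wilsonAction (d := d) (L := L) ρ) (wilsonMeasure (d := d) (L := L) ρ u) := by
    intro i hi u hu
    refine wilson_variance_ge_half_anyGroup ρ hρ hρu hL u ?_
    rw [← hvdef, abs_le]
    have h1 : β 0 ≤ β i := hmono i hi.le 0 (Nat.zero_le i)
    have h2 : β (i + 1) ≤ β k := hmono k le_rfl (i + 1) hi
    have h3 : β i + δ i = β (i + 1) := (hstep i).symm
    exact ⟨by linarith [hu.1], by linarith [hu.2, hD i hi]⟩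
  have h := schedule_sum_ge_of_floors (d := d) (L := L) ρ hρ k β δ (fun _ => v * P / 2) hδ hfloor
  -- `v P (β_k − β_0)² / (2k) ≤ Σ δ_i² (vP/2)` by Cauchy–Schwarz
  have hk0 : (0 : ℝ) < k := by exact_mod_cast hk
  have hcs := Finset.sum_mul_sq_le_sq_mul_sq (Finset.range k) (fun _ => (1 : ℝ)) (fun i => δ i)
  simp only [one_mul, one_pow, Finset.sum_const, Finset.card_range, nsmul_eq_mul, mul_one] at hcs
  have hΔ : β k - β 0 = ∑ i ∈ Finset.range k, δ i := by rw [hsum k]; ring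
  have hbound : v * P * (β k - β 0) ^ 2 / (2 * k) ≤ ∑ i ∈ Finset.range k, δ i ^ 2 * (v * P / 2) := by
    rw [hΔ, div_le_iff₀ (by positivity), ← Finset.sum_mul]
    nlinarith [hcs, hm0]
  exact hbound.trans h

end StrongCoupling

section U1

open Literature.MathematicalPhysics.QuantumLattice (u1Rep continuous_u1Rep u1Rep_mem_unitaryGroup)

variable {d L : ℕ} [NeZero L] [MeasurableSpace Circle] [BorelSpace Circle]

/-- **`U(1)`, STRONG COUPLING, EVERY `L ≥ 2`: one exact reweighting step of size `δ ≥ 0` with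
`[β, β+2δ]` in the window `|x| ≤ min (r/8) (r³/1024)`, `r = 1/(8e(3^d d²+1)²)`, has weight second
moment `≥ exp(δ²·#plaq/4)`.** [ours] -/
theorem u1_weight_sq_ge_exp (hL : 2 ≤ L) {β δ : ℝ} (hδ : 0 ≤ δ)
    (hβ : |β| ≤ min (1 / (8 * Real.exp 1 * ((3 : ℝ) ^ d * (d : ℝ) ^ 2 + 1) ^ 2) / 8)
      ((1 / (8 * Real.exp 1 * ((3 : ℝ) ^ d * (d : ℝ) ^ 2 + 1) ^ 2)) ^ 3 / 1024))
    (hβ2 : |β + 2 * δ| ≤ min (1 / (8 * Real.exp 1 * ((3 : ℝ) ^ d * (d : ℝ) ^ 2 + 1) ^ 2) / 8)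
      ((1 / (8 * Real.exp 1 * ((3 : ℝ) ^ d * (d : ℝ) ^ 2 + 1) ^ 2)) ^ 3 / 1024)) :
    Real.exp (δ ^ 2 * (Fintype.card (Plaquette d L) / 4)) ≤
      ∫ U, (Real.exp (-(δ * wilsonAction u1Rep U)) *
        (mgf (fun U => -wilsonAction u1Rep U) (trivialMeasure Circle d L) β /
          mgf (fun U => -wilsonAction u1Rep U) (trivialMeasure Circle d L) (β + δ))) ^ 2
      ∂(wilsonMeasure (d := d) (L := L) u1Rep β) := by
  have hmax : max 1 (2 * ((1 : ℕ) : ℝ)) = 2 := by norm_num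
  have hr : 1 / (4 * Real.exp 1 * max 1 (2 * ((1 : ℕ) : ℝ)) * ((3 : ℝ) ^ d * (d : ℝ) ^ 2 + 1) ^ 2) =
      1 / (8 * Real.exp 1 * ((3 : ℝ) ^ d * (d : ℝ) ^ 2 + 1) ^ 2) := by rw [hmax]; ring
  have h1024 : (1 / (8 * Real.exp 1 * ((3 : ℝ) ^ d * (d : ℝ) ^ 2 + 1) ^ 2)) ^ 3 / 1024 =
      1 / 2 * (1 / (8 * Real.exp 1 * ((3 : ℝ) ^ d * (d : ℝ) ^ 2 + 1) ^ 2)) ^ 3 / 512 := by ring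
  have h := wilson_weight_sq_ge_exp_anyGroup (d := d) (L := L) u1Rep continuous_u1Rep
    u1Rep_mem_unitaryGroup hL hδ (by rw [hr, variance_re_haar_circle, ← h1024]; exact hβ)
    (by rw [hr, variance_re_haar_circle, ← h1024]; exact hβ2)
  rw [variance_re_haar_circle] at h
  convert h using 3
  ring

end U1

end Summit.Ventures.LatticeQCDFlow.TrivializingMaps
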